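import Mathlib
import Literature.Analysis.FluidPDE.BiotSavartRepresentationSqIntegrable
import Literature.Analysis.FluidPDE.ConstantinDirectionDissipationCalculus
import Literature.Analysis.FluidPDE.VorticityCalculus
import Literature.Analysis.FluidPDE.ClassicalSuitable
import Summits.NavierStokesRegularity.NavierStokesRegularity.Theorems.EulerZoomLiouvillePowerGaugeEulerLiouvilleCompactVortexVolumeEnergy

/-!
# Crux `EulerZoomLiouville.PowerGaugeEulerLiouville` (stmt-NavierStokesRegularity-19832) — the forward refutation door has
# FAT VORTICITY: an energy floor and square-summable enstrophy force unbounded vortex volume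

Negative-lane structure record (prover hand leafhand-ns-eulerzoomliouville-8 g0; `--supports` stmt-19832).  By
`…Negative.ForwardRelaxingClassicalFlow`, the window `0 < ρ ≤ ½` of the crux is refuted by any global classical
finite-energy Euler flow on `(0,∞) × ℝ³` with square-summable enstrophy `∫₀^∞∫|∇v|²_F < ∞` (+ a pressure budget).
This file closes the THIN-VORTICITY part of that door, by pure kinematics (no Euler equation is used):

* `energy_le_vortexVolume_mul_enstrophy` — for a `C²` divergence-free field `v` on `ℝ³` with `v, curl v ∈ L²` and
  compactly supported vorticity, `∫|v|² ≤ C · vol(supp curl v)^{2/3} · ∫|curl v|²` with the universal constant of the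
  line `vortex-volume` (`CompactVortex.vortexVolumeEnergyIneq`: Biot–Savart + Hardy–Littlewood–Sobolev + Hölder on
  the support; here composed with the tree's Biot–Savart representation `biotSavart_curl_eq_self_of_lintegral_sq_lt_top`).
* `setLIntegral_enstrophy_eq_top_of_energyFloor` — a jointly `C¹` velocity `v` on `(0,∞) × ℝ³` with `C²`
  divergence-free `L²` slices, an ENERGY FLOOR `∫|v(s)|² ≥ E₀ > 0`, and compactly supported vorticity slices of volume
  `≤ V₀ < ∞` has `∫∫_{(0,∞)×ℝ³} |∇v|²_F = ∞` (slice enstrophy `≥ E₀ /(2 C V₀^{2/3})`, Tonelli).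
* `no_thinVorticity_relaxingFlow` — hence NO flow with these properties has a finite space–time enstrophy budget: a
  forward relaxing flow refuting the crux (if any) keeps its energy only by spreading its vorticity over sets of
  UNBOUNDED volume (or non-compact support).  For classical finite-energy Euler flows the energy floor is automatic
  (energy conservation), and vortex volume is a Lagrangian invariant — so smooth compactly-supported-vorticity Euler
  flows are never relaxing; neither fact is invoked here (both enter as hypotheses / conclusions about the door only).

WHAT THIS IS NOT: not a refutation or proof of the crux, of a stub, or of the route; not a claim about Navier–Stokes.
[folklore; Stein1971 Ch. V §1.2 Thm 1 (b) via the tree] -/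

noncomputable section
set_option linter.dupNamespace false
namespace Summit.NavierStokesRegularity.NavierStokesRegularity.Theorems.PowerGaugeEulerLiouville.Negative

open MeasureTheory Set Function Filter Topology Metric Literature.Analysis Literature.Analysis.FluidPDE
open scoped NNReal ENNReal

/-! ## Energy ≤ C · (vortex volume)^{2/3} · enstrophy -/

/-- **Energy is slaved to vortex volume and enstrophy.**  There is a universal `C` such that every `C²` divergence-free
field `v` on `ℝ³` with `∫|v|² < ∞`, `∫|curl v|² < ∞` and compactly supported vorticity satisfies
`∫|v|² ≤ C · vol(supp curl v)^{2/3} · ∫|curl v|²` (Biot–Savart representation + the volume-slaving inequality of the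
line `vortex-volume`). [folklore] -/
theorem energy_le_vortexVolume_mul_enstrophy :
    ∃ C : ℝ≥0, ∀ v : EuclideanSpace ℝ (Fin 3) → EuclideanSpace ℝ (Fin 3), ContDiff ℝ 2 v →
      VectorCalculus.IsDivFree v → ∫⁻ x, ‖v x‖ₑ ^ 2 < ⊤ → ∫⁻ x, ‖curl v x‖ₑ ^ 2 < ⊤ →
      HasCompactSupport (curl v) →
      ∫⁻ x, ‖v x‖ₑ ^ 2 ≤
        (C : ℝ≥0∞) * volume (Function.support (curl v)) ^ (2 / 3 : ℝ) * ∫⁻ x, ‖curl v x‖ₑ ^ 2 := by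
  obtain ⟨C, hC⟩ := CompactVortex.vortexVolumeEnergyIneq
  refine ⟨C, fun v hv hdiv hv2 hω2 hcpt => ?_⟩
  have hωc : Continuous (curl v) := continuous_curl (hv.of_le (by norm_num))
  have h := hC (curl v) hωc hcpt
  rwa [biotSavart_curl_eq_self_of_lintegral_sq_lt_top hv hdiv hv2 hω2] at h

/-- Pointwise `‖curl v‖ₑ² ≤ 2 |∇v|²_F` in `[0,∞]`. [folklore] -/
theorem enorm_curl_sq_le_two_mul_ofReal_frobeniusNormSq
    (v : EuclideanSpace ℝ (Fin 3) → EuclideanSpace ℝ (Fin 3)) (x : EuclideanSpace ℝ (Fin 3)) :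
    ‖curl v x‖ₑ ^ 2 ≤ 2 * ENNReal.ofReal (frobeniusNormSq (fderiv ℝ v x)) := by
  rw [← ofReal_norm, ← ENNReal.ofReal_pow (norm_nonneg _)]
  calc ENNReal.ofReal (‖curl v x‖ ^ 2) ≤ ENNReal.ofReal (2 * frobeniusNormSq (fderiv ℝ v x)) :=
        ENNReal.ofReal_le_ofReal (norm_curl_sq_le_two_mul_frobeniusNormSq v x)
    _ = 2 * ENNReal.ofReal (frobeniusNormSq (fderiv ℝ v x)) := by
        rw [ENNReal.ofReal_mul (by norm_num : (0 : ℝ) ≤ 2), ENNReal.ofReal_ofNat]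

/-- Slice form: `∫‖curl v‖ₑ² ≤ 2 ∫ |∇v|²_F`. [folklore] -/
theorem lintegral_enorm_curl_sq_le_two_mul (v : EuclideanSpace ℝ (Fin 3) → EuclideanSpace ℝ (Fin 3)) :
    ∫⁻ x, ‖curl v x‖ₑ ^ 2 ≤ 2 * ∫⁻ x, ENNReal.ofReal (frobeniusNormSq (fderiv ℝ v x)) := by
  rw [← lintegral_const_mul' _ _ (by norm_num)]
  exact lintegral_mono fun x => enorm_curl_sq_le_two_mul_ofReal_frobeniusNormSq v x

/-! ## The door theorem: energy floor + thin vorticity ⇒ infinite space–time enstrophy -/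

/-- **ENERGY FLOOR + THIN VORTICITY ⇒ INFINITE SPACE–TIME ENSTROPHY.**  Let `v` be jointly `C¹` on `(0,∞) × ℝ³` with
`C²` divergence-free slices, `∫|v(s)|² < ∞`, `∫|curl v(s)|² < ∞`, compactly supported vorticity slices of volume
`vol(supp curl v(s)) ≤ V₀ < ∞`, and an energy floor `E₀ ≤ ∫|v(s)|²`, `E₀ > 0`, for all `s > 0`.  Then
`∫∫_{(0,∞)×ℝ³} |∇v|²_F = ∞`: each slice has `∫|∇v(s)|²_F ≥ E₀/(2 C V₀^{2/3}) > 0`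
(`energy_le_vortexVolume_mul_enstrophy`), and Tonelli sums the floor over `(0,∞)`. [folklore] -/
theorem setLIntegral_enstrophy_eq_top_of_energyFloor
    {v : ℝ → EuclideanSpace ℝ (Fin 3) → EuclideanSpace ℝ (Fin 3)}
    (hv : ContDiffOn ℝ 1 (uncurry v) (Ioi (0 : ℝ) ×ˢ (univ : Set (EuclideanSpace ℝ (Fin 3)))))
    (hC2 : ∀ s : ℝ, 0 < s → ContDiff ℝ 2 (v s)) (hdiv : ∀ s : ℝ, 0 < s → VectorCalculus.IsDivFree (v s))
    (hfin : ∀ s : ℝ, 0 < s → ∫⁻ x, ‖v s x‖ₑ ^ 2 < ⊤)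
    (hωfin : ∀ s : ℝ, 0 < s → ∫⁻ x, ‖curl (v s) x‖ₑ ^ 2 < ⊤)
    (hcpt : ∀ s : ℝ, 0 < s → HasCompactSupport (curl (v s)))
    {E₀ V₀ : ℝ≥0∞} (hE₀ : E₀ ≠ 0) (hV₀ : V₀ ≠ ⊤)
    (hfloor : ∀ s : ℝ, 0 < s → E₀ ≤ ∫⁻ x, ‖v s x‖ₑ ^ 2)
    (hvol : ∀ s : ℝ, 0 < s → volume (Function.support (curl (v s))) ≤ V₀) :
    ∫⁻ z in Ioi (0 : ℝ) ×ˢ (univ : Set (EuclideanSpace ℝ (Fin 3))),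
      ENNReal.ofReal (frobeniusNormSq (fderiv ℝ (v z.1) z.2)) = ⊤ := by
  obtain ⟨C, hC⟩ := energy_le_vortexVolume_mul_enstrophy
  -- the slice constant `K = 2 C V₀^{2/3}` and the floor `φ₀ = E₀ / K`
  set K : ℝ≥0∞ := (C : ℝ≥0∞) * V₀ ^ (2 / 3 : ℝ) * 2 with hK
  have hKtop : K ≠ ⊤ := ENNReal.mul_ne_top
    (ENNReal.mul_ne_top ENNReal.coe_ne_top (ENNReal.rpow_ne_top_of_nonneg (by norm_num) hV₀)) (by norm_num)
  set Φ : ℝ → ℝ≥0∞ := fun s => ∫⁻ x, ENNReal.ofReal (frobeniusNormSq (fderiv ℝ (v s) x)) with hΦ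
  have hslice : ∀ s : ℝ, 0 < s → E₀ / K ≤ Φ s := by
    intro s hs
    refine ENNReal.div_le_of_le_mul ?_
    calc E₀ ≤ ∫⁻ x, ‖v s x‖ₑ ^ 2 := hfloor s hs
      _ ≤ (C : ℝ≥0∞) * volume (Function.support (curl (v s))) ^ (2 / 3 : ℝ) * ∫⁻ x, ‖curl (v s) x‖ₑ ^ 2 :=
          hC (v s) (hC2 s hs) (hdiv s hs) (hfin s hs) (hωfin s hs) (hcpt s hs)
      _ ≤ (C : ℝ≥0∞) * V₀ ^ (2 / 3 : ℝ) * (2 * Φ s) := by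
          gcongr
          · exact hvol s hs
          · exact lintegral_enorm_curl_sq_le_two_mul (v s)
      _ = Φ s * K := by rw [hK]; ring
  have hφ0 : E₀ / K ≠ 0 := (ENNReal.div_pos_iff.2 ⟨hE₀, hKtop⟩).ne'
  -- Tonelli on the half slab
  have hslice_cont : ContinuousOn (fun z : ℝ × EuclideanSpace ℝ (Fin 3) => fderiv ℝ (v z.1) z.2)
      (Ioi (0 : ℝ) ×ˢ (univ : Set (EuclideanSpace ℝ (Fin 3)))) :=
    continuousOn_fderiv_slice_of_contDiffOn hv isOpen_Ioi.uniqueDiffOn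
  have hFcont : ContinuousOn
      (fun z : ℝ × EuclideanSpace ℝ (Fin 3) => ENNReal.ofReal (frobeniusNormSq (fderiv ℝ (v z.1) z.2)))
      (Ioi (0 : ℝ) ×ˢ (univ : Set (EuclideanSpace ℝ (Fin 3)))) :=
    ENNReal.continuous_ofReal.comp_continuousOn
      (LerayHopfProofs.continuous_frobeniusNormSq.comp_continuousOn hslice_cont)
  have hmeas : MeasurableSet (Ioi (0 : ℝ) ×ˢ (univ : Set (EuclideanSpace ℝ (Fin 3)))) :=
    measurableSet_Ioi.prod MeasurableSet.univ
  have hF : AEMeasurable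
      (fun z : ℝ × EuclideanSpace ℝ (Fin 3) => ENNReal.ofReal (frobeniusNormSq (fderiv ℝ (v z.1) z.2)))
      (((volume : Measure ℝ).prod (volume : Measure (EuclideanSpace ℝ (Fin 3)))).restrict
        (Ioi (0 : ℝ) ×ˢ (univ : Set (EuclideanSpace ℝ (Fin 3))))) := by
    rw [← Measure.volume_eq_prod]
    exact hFcont.aemeasurable hmeas
  rw [Measure.volume_eq_prod, setLIntegral_prod _ hF]
  simp only [Measure.restrict_univ]
  refine eq_top_iff.2 ?_
  calc (⊤ : ℝ≥0∞) = E₀ / K * volume (Ioi (0 : ℝ)) := by rw [Real.volume_Ioi, ENNReal.mul_top hφ0]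
    _ = ∫⁻ _ in Ioi (0 : ℝ), E₀ / K := (setLIntegral_const _ _).symm
    _ ≤ ∫⁻ s in Ioi (0 : ℝ), Φ s := setLIntegral_mono' measurableSet_Ioi fun s hs => hslice s hs

/-- **NO THIN-VORTICITY RELAXING FLOW.**  A jointly `C¹` velocity on `(0,∞) × ℝ³` with `C²` divergence-free `L²`
slices, an energy floor `E₀ > 0`, compactly supported vorticity slices of volume `≤ V₀ < ∞`, and a FINITE space–time
enstrophy budget `∫∫_{(0,∞)×ℝ³}|∇v|²_F ≤ M` does not exist.  In particular the forward refutation door of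
`…Negative.ForwardRelaxingClassicalFlow` (where, for classical finite-energy Euler flows, the energy floor is
automatic) contains no flow with thin compactly supported vorticity. [folklore] -/
theorem no_thinVorticity_relaxingFlow
    {v : ℝ → EuclideanSpace ℝ (Fin 3) → EuclideanSpace ℝ (Fin 3)} {M : ℝ≥0}
    (hv : ContDiffOn ℝ 1 (uncurry v) (Ioi (0 : ℝ) ×ˢ (univ : Set (EuclideanSpace ℝ (Fin 3)))))
    (hC2 : ∀ s : ℝ, 0 < s → ContDiff ℝ 2 (v s)) (hdiv : ∀ s : ℝ, 0 < s → VectorCalculus.IsDivFree (v s))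
    (hfin : ∀ s : ℝ, 0 < s → ∫⁻ x, ‖v s x‖ₑ ^ 2 < ⊤)
    (hωfin : ∀ s : ℝ, 0 < s → ∫⁻ x, ‖curl (v s) x‖ₑ ^ 2 < ⊤)
    (hcpt : ∀ s : ℝ, 0 < s → HasCompactSupport (curl (v s)))
    {E₀ V₀ : ℝ≥0∞} (hE₀ : E₀ ≠ 0) (hV₀ : V₀ ≠ ⊤)
    (hfloor : ∀ s : ℝ, 0 < s → E₀ ≤ ∫⁻ x, ‖v s x‖ₑ ^ 2)
    (hvol : ∀ s : ℝ, 0 < s → volume (Function.support (curl (v s))) ≤ V₀)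
    (hE : ∫⁻ z in Ioi (0 : ℝ) ×ˢ (univ : Set (EuclideanSpace ℝ (Fin 3))),
      ENNReal.ofReal (frobeniusNormSq (fderiv ℝ (v z.1) z.2)) ≤ (M : ℝ≥0∞)) : False := by
  have h := setLIntegral_enstrophy_eq_top_of_energyFloor hv hC2 hdiv hfin hωfin hcpt hE₀ hV₀ hfloor hvol
  rw [h] at hE
  exact ENNReal.coe_ne_top (top_le_iff.1 hE)

end Summit.NavierStokesRegularity.NavierStokesRegularity.Theorems.PowerGaugeEulerLiouville.Negative
end
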